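/-
Copyright: the b2b-balaban cell (near-miss cell 7), T⁴-continuum CRUX team (coordinator ruling e34b3e0c item (2)),
seat t4-ne7b-formalise-leaf-05 (gen 67). Released under the licence of the surrounding project.
-/
import Summits.QuantumFields.BalabanUV.T4Continuum.Spine.NE7b.ScreeningGrowthBeatsGeometric

/-!
# The growth lemma S4 of R-SI along the radii `R = 4^k·r₀`: from the master inequality (★) to super-`exp(R^{1/5})` growth
# (estimate NE7b, `t4/ROUTES-NE7b.md` v12, block «WHAT CHANGED v11.3 → v12» item (3): (★a)/(★b), S4, corollary LV2⁺)

Third file of the S4 package (`…Spine.NE7b.ScreeningGrowthLemma` = the dynamics, `…ScreeningGrowthBeatsGeometric` =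
the headline). ROUTES-NE7b v12 Δv12 (3) applies S4 «with `E_k := e(4^k r₀)` at a point `x₀` where `|F_A(x₀)| =: M > 0`
and `r₀ := 2(C₀√ε₀/M)^{1/2}` (so `e(r₀) > ε₀` by ε-regularity's contrapositive), (★) at `r = 2·4^k r₀` feeds S4 with
`E_{k+1} − E_k ≥ a` and `e(r) ≥ E_k`», where `e(r) := ∫_{B_r(x₀)}|F_A|²`, `a(r) := e(2r) − e(r/2)` and the MASTER
INEQUALITY reads: (★a) `a(r) ≤ ε₀ ⇒ e(r) ≤ C_a·a(r)`; (★b) `a(r) ≥ ε₀ ⇒ e(r) ≤ C_b·(a(r)/ε₀)^{3/4}`; corollary LV2⁺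
concludes «no non-flat smooth class-free local minimiser on ℝ⁴ has `∫_{B_R}|F_A|² ≤ exp(R^{1/5})` for all large `R`».

THIS FILE PROVES the geometry-free skeleton of that application, for an ARBITRARY function `e : ℝ → ℝ` that is
nondecreasing on `[r₀, ∞)` (as `r ↦ ∫_{B_r}|F|²` is), satisfies (★a) and (★b) at every `r ≥ r₀`, and starts with
`ε₀ ≤ e r₀` (namespace `…NE7b.ScreeningGrowth`):
* `annulus_eq` — at `r = 2·4^k·r₀`: `e (2r) − e (r/2) = e (4^{k+1} r₀) − e (4^k r₀)` (the annulus energy IS the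
  increment of `E_k := e (4^k r₀)`), and `radius_le` — `e (4^k r₀) ≤ e r`;
* `hyp_of_master` — (★a) ∧ (★b) on `[r₀, ∞)` + monotonicity + `ε₀ ≤ e r₀` ⇒ the standing hypothesis `h` of S4
  (the conjunction of `ScreeningGrowthLemma`) for `E := fun k => e (4^k·r₀)`;
* `master_eventually_gt_exp_radius_fifth` — hence eventually `exp ((4^k r₀)^{1/5}) < e (4^k r₀)`;
* `master_not_subexp_fifth` — hence it is FALSE that `e R ≤ exp (R^{1/5})` for all large `R`: the arithmetic skeleton
  of LV2⁺, whose remaining inputs are exactly (★) (steps S1–S3: flat approximation, screening competitor, covering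
  count — geometry, OPEN in words) and the ε-regularity start `ε₀ ≤ e r₀` at a point of non-zero curvature.

HONEST FRAMING. Law-free real analysis about one real function; (★) is a HYPOTHESIS here (displayed with all
parameters free, never asserted), ε-regularity is not touched, no gauge field appears; nothing of [Bałaban 1983–89]
read, asserted or cited. R-SI stays «rank 3 CANDIDATE, 0 seats, unfunded, price HIGH»; C-RH° stays KILL PROPOSED
2026-08-28 with the author's concurrence. NE7b (`T4WeightBudget.RelWeightBound`) NOT PRINTED and NOT PROVED; spine
PROVED 0∕9; rung (B)+1 on a FINITE torus T⁴ — NOT infinite volume, NOT the mass gap, NOT Clay. HONEST DEPENDENCY: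
continuum YM on T⁴ ⇐ BetaPertH ∧ nine spine estimates (0/9 proved); BetaPertH ⇐ (D1) ∧ (D4) ∧ CAP+tail; G-an2-4
gates asym, D1 and NE2/3/4. POLICY: crux-route work under `Spine/NE7b/`, not a `T4Continuum/Support` leaf (FREEZE (0)
respected); 0 `def`, no `Prop`-valued fact, no `[cite:]` fact.
-/

set_option autoImplicit false

namespace Summit.QuantumFields.BalabanUV.T4Continuum.NE7b.ScreeningGrowth

section Radii

variable {e : ℝ → ℝ} {ε₀ Ca Cb r₀ : ℝ}

/-- Radius bookkeeping at `r = 2·4^k·r₀`: `2r = 4^{k+1}·r₀` and `r/2 = 4^k·r₀`, so the annulus energy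
`e (2r) − e (r/2)` is exactly the increment `e (4^{k+1} r₀) − e (4^k r₀)`. -/
theorem annulus_eq (e : ℝ → ℝ) (r₀ : ℝ) (k : ℕ) :
    e (2 * (2 * 4 ^ k * r₀)) - e (2 * 4 ^ k * r₀ / 2) = e (4 ^ (k + 1) * r₀) - e (4 ^ k * r₀) := by
  have h1 : 2 * (2 * (4 : ℝ) ^ k * r₀) = 4 ^ (k + 1) * r₀ := by rw [pow_succ]; ring
  have h2 : 2 * (4 : ℝ) ^ k * r₀ / 2 = 4 ^ k * r₀ := by ring
  rw [h1, h2]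

/-- With `e` nondecreasing on `[r₀, ∞)` and `r₀ ≥ 0`: `e (4^k r₀) ≤ e (2·4^k r₀)`. -/
theorem radius_le (hr : 0 ≤ r₀) (hmono : ∀ s t : ℝ, r₀ ≤ s → s ≤ t → e s ≤ e t) (k : ℕ) :
    e (4 ^ k * r₀) ≤ e (2 * 4 ^ k * r₀) := by
  have h4 : (1 : ℝ) ≤ 4 ^ k := one_le_pow₀ (by norm_num)
  apply hmono
  · nlinarith
  · nlinarith

/-- FROM THE MASTER INEQUALITY TO S4's HYPOTHESIS. If `e` is nondecreasing on `[r₀, ∞)` (`r₀ ≥ 0`), `ε₀ ≤ e r₀`, and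
(★a) `e (2r) − e (r/2) ≤ ε₀ → e r ≤ Ca·(e (2r) − e (r/2))`, (★b) `ε₀ ≤ e (2r) − e (r/2) → e r ≤ Cb·((e (2r) − e (r/2))/ε₀)^{3/4}`
hold at every `r ≥ r₀`, then `E k := e (4^k·r₀)` satisfies the standing hypothesis of `ScreeningGrowthLemma`
((★) is used at `r = 2·4^k·r₀` only). -/
theorem hyp_of_master (hε : 0 < ε₀) (hCa : 0 < Ca) (hCb : 0 < Cb) (hr : 0 ≤ r₀)
    (hmono : ∀ s t : ℝ, r₀ ≤ s → s ≤ t → e s ≤ e t) (hstart : ε₀ ≤ e r₀)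
    (hA : ∀ r : ℝ, r₀ ≤ r → e (2 * r) - e (r / 2) ≤ ε₀ → e r ≤ Ca * (e (2 * r) - e (r / 2)))
    (hB : ∀ r : ℝ, r₀ ≤ r → ε₀ ≤ e (2 * r) - e (r / 2) →
      e r ≤ Cb * ((e (2 * r) - e (r / 2)) / ε₀) ^ (3 / 4 : ℝ)) :
    0 < ε₀ ∧ 0 < Ca ∧ 0 < Cb ∧ ε₀ ≤ e (4 ^ 0 * r₀) ∧ ∀ k : ℕ,
      (e (4 ^ (k + 1) * r₀) - e (4 ^ k * r₀) ≤ ε₀ ∧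
        e (4 ^ k * r₀) ≤ Ca * (e (4 ^ (k + 1) * r₀) - e (4 ^ k * r₀))) ∨
      (ε₀ ≤ e (4 ^ (k + 1) * r₀) - e (4 ^ k * r₀) ∧
        e (4 ^ k * r₀) ≤ Cb * ((e (4 ^ (k + 1) * r₀) - e (4 ^ k * r₀)) / ε₀) ^ (3 / 4 : ℝ)) := by
  refine hyp_of_imp (E := fun k : ℕ => e (4 ^ k * r₀)) hε hCa hCb (by simpa using hstart)
    (fun k hk => ?_) (fun k hk => ?_)
  · -- hole-filling branch at r = 2·4^k·r₀
    have hr' : r₀ ≤ 2 * 4 ^ k * r₀ := by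
      have h4 : (1 : ℝ) ≤ 4 ^ k := one_le_pow₀ (by norm_num)
      nlinarith
    have h1 := hA (2 * 4 ^ k * r₀) hr'
    rw [annulus_eq e r₀ k] at h1
    have h2 := radius_le hr hmono k
    have hk' : e (4 ^ (k + 1) * r₀) - e (4 ^ k * r₀) ≤ ε₀ := hk
    show e (4 ^ k * r₀) ≤ Ca * (e (4 ^ (k + 1) * r₀) - e (4 ^ k * r₀))
    linarith [h1 hk']
  · -- isoperimetric branch at r = 2·4^k·r₀
    have hr' : r₀ ≤ 2 * 4 ^ k * r₀ := by
      have h4 : (1 : ℝ) ≤ 4 ^ k := one_le_pow₀ (by norm_num)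
      nlinarith
    have h1 := hB (2 * 4 ^ k * r₀) hr'
    rw [annulus_eq e r₀ k] at h1
    have h2 := radius_le hr hmono k
    have hk' : ε₀ ≤ e (4 ^ (k + 1) * r₀) - e (4 ^ k * r₀) := hk
    show e (4 ^ k * r₀) ≤ Cb * ((e (4 ^ (k + 1) * r₀) - e (4 ^ k * r₀)) / ε₀) ^ (3 / 4 : ℝ)
    linarith [h1 hk']

/-- LV2⁺'s growth, arithmetic half: under (★) on `[r₀, ∞)`, monotonicity and the start `ε₀ ≤ e r₀`, eventually
`exp ((4^k·r₀)^{1/5}) < e (4^k·r₀)`. -/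
theorem master_eventually_gt_exp_radius_fifth (hε : 0 < ε₀) (hCa : 0 < Ca) (hCb : 0 < Cb) (hr : 0 ≤ r₀)
    (hmono : ∀ s t : ℝ, r₀ ≤ s → s ≤ t → e s ≤ e t) (hstart : ε₀ ≤ e r₀)
    (hA : ∀ r : ℝ, r₀ ≤ r → e (2 * r) - e (r / 2) ≤ ε₀ → e r ≤ Ca * (e (2 * r) - e (r / 2)))
    (hB : ∀ r : ℝ, r₀ ≤ r → ε₀ ≤ e (2 * r) - e (r / 2) →
      e r ≤ Cb * ((e (2 * r) - e (r / 2)) / ε₀) ^ (3 / 4 : ℝ)) :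
    ∃ K : ℕ, ∀ k : ℕ, K ≤ k → Real.exp (((4 : ℝ) ^ k * r₀) ^ (1 / 5 : ℝ)) < e (4 ^ k * r₀) :=
  eventually_gt_exp_radius_fifth (E := fun k : ℕ => e (4 ^ k * r₀))
    (hyp_of_master hε hCa hCb hr hmono hstart hA hB) r₀ hr

/-- LV2⁺'s ARITHMETIC SKELETON: under (★) on `[r₀, ∞)`, monotonicity on `[r₀, ∞)` and the start `ε₀ ≤ e r₀`
(`r₀ > 0`), it is FALSE that `e R ≤ exp (R^{1/5})` for all large `R`. (What remains of LV2⁺ is exactly (★) — steps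
S1–S3 of R-SI — and the ε-regularity start at a point of non-zero curvature; both OPEN, in words.) -/
theorem master_not_subexp_fifth (hε : 0 < ε₀) (hCa : 0 < Ca) (hCb : 0 < Cb) (hr : 0 < r₀)
    (hmono : ∀ s t : ℝ, r₀ ≤ s → s ≤ t → e s ≤ e t) (hstart : ε₀ ≤ e r₀)
    (hA : ∀ r : ℝ, r₀ ≤ r → e (2 * r) - e (r / 2) ≤ ε₀ → e r ≤ Ca * (e (2 * r) - e (r / 2)))
    (hB : ∀ r : ℝ, r₀ ≤ r → ε₀ ≤ e (2 * r) - e (r / 2) →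
      e r ≤ Cb * ((e (2 * r) - e (r / 2)) / ε₀) ^ (3 / 4 : ℝ)) :
    ¬ ∃ R₀ : ℝ, ∀ R : ℝ, R₀ ≤ R → e R ≤ Real.exp (R ^ (1 / 5 : ℝ)) := by
  rintro ⟨R₀, hR⟩
  obtain ⟨K, hK⟩ := master_eventually_gt_exp_radius_fifth hε hCa hCb hr.le hmono hstart hA hB
  -- choose k ≥ K with 4^k·r₀ ≥ R₀ (possible since 4^k ≥ k + 1 > R₀/r₀ for large k)
  obtain ⟨n, hn⟩ := exists_nat_gt (R₀ / r₀)
  set k := max K n with hk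
  have hKk : K ≤ k := le_max_left _ _
  have hnk : (n : ℝ) ≤ k := by exact_mod_cast le_max_right K n
  have h4k : (k : ℝ) + 1 ≤ (4 : ℝ) ^ k := by
    have := one_add_mul_le_pow (by norm_num : (-2 : ℝ) ≤ 3) k
    have h3 : (k : ℝ) ≤ (k : ℝ) * 3 := by nlinarith [Nat.cast_nonneg (α := ℝ) k]
    calc (k : ℝ) + 1 ≤ 1 + (k : ℝ) * 3 := by linarith
      _ ≤ (1 + 3) ^ k := this
      _ = (4 : ℝ) ^ k := by norm_num
  have hRk : R₀ ≤ (4 : ℝ) ^ k * r₀ := by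
    have h1 : R₀ / r₀ < (4 : ℝ) ^ k := by linarith
    have h2 := (div_lt_iff₀ hr).1 h1
    linarith
  have h1 := hR ((4 : ℝ) ^ k * r₀) hRk
  have h2 := hK k hKk
  linarith

end Radii

end Summit.QuantumFields.BalabanUV.T4Continuum.NE7b.ScreeningGrowth
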